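import Literature.MathematicalPhysics.KineticTheory.ReyBelletThomas2002Kernel
import Literature.MathematicalPhysics.KineticTheory.ConfinedControlReach
import Literature.MathematicalPhysics.KineticTheory.ChainControl
import HarnessLib

/-!
# Rey-Bellet–Thomas 2002, Proposition 4.2: irreducibility of the effective dynamics

Trunk T-KINETIC (Literature/MathematicalPhysics/KineticTheory). Inline decomposition step for the
named fact `ReyBelletThomas2002_thm21` (provefact unit): **irreducibility of (RBT-SDE)** — for
every `t > 0`, every starting point and every nonempty open set `U`, `P_t(x, U) > 0` — proved as
in §4 of the paper from the support theorem (easy half, `ConfinedControlReach.lean`) and the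
controllability of the associated control system
`q̇ = p`, `ṗ = -∇_qV - Λᵀ r`, `ṙ = -γ r + Λ p + u` (eq. (46) of the paper). The controllability
is obtained here under H1 ALONE in the form "`∇U⁽²⁾ = V'` is onto" (`k₂ > 1`), by the one-ended
approximate controllability of the chain (`ChainControl.lean`): the auxiliary variable `r_L` is a
free `C²` path (its equation is absorbed by the control `u_L`), it forces the end site `0` through
`-Λ r_L`, which tracks in `L¹` (with prescribed end values of `r_L`) the force profile steering
the chain (`ForceTracking.lean`), while `r_R` is moved to its target value with an `L¹`-small
force on the other end; Grönwall robustness absorbs both errors.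

* `RBGrowth.surjective_deriv` — H1 with `k > 1` makes `W'` onto (`W'(±s) ~ ±a k s^{k-1}`);
* `OscillatorChain.rb_exists_control` — **controllability of (46)**: for all `x₀, x_T`, `T > 0`,
  `ε > 0` there is a noise path `n` (continuous, in the reservoir subspace, `n(0) = 0`, Lipschitz
  on `[0, T]`) whose driven trajectory `drivenFlow` from `x₀` is `ε`-close to `x_T` at time `T`;
* `OscillatorChain.rb_kernel_pos_of_isOpen` — **Prop. 4.2 (irreducibility)**: under H1
  (`1 ≤ k₁`, `1 < k₂`), `γ, T_L, T_R > 0`, `Λ ≠ 0`, `N ≥ 1`: `P_t(x, U) > 0` for every `t > 0`,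
  `x`, and nonempty open `U`; `rb_irreducible` — the `∃ t > 0` form consumed by the §5 assembly.

## References

* L. Rey-Bellet, L. E. Thomas, Comm. Math. Phys. **225** (2002) 305–329, §4, Prop. 4.2, eq. (46).
* D. W. Stroock, S. R. S. Varadhan, Proc. Sixth Berkeley Symp. III (1972) 333–359 (support theorem).
* J.-P. Eckmann, C.-A. Pillet, L. Rey-Bellet, J. Stat. Phys. **95** (1999) 305–331, Thm 3.2.
-/

noncomputable section

open MeasureTheory Set Filter Topology intervalIntegral Metric
open scoped NNReal ENNReal Interval

namespace Literature.MathematicalPhysics.KineticTheory.HeatConduction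

open Literature.Analysis.ODE Literature.MathematicalPhysics.KineticTheory
  Literature.Probability.Process

variable {N : ℕ}

/-! ### H1 makes `V'` onto -/

namespace RBGrowth

variable {W : ℝ → ℝ} {k : ℝ}

/-- **H1 with `k > 1` makes the force onto**: from `W'(sx)/s^{k-1} → a k |x|^{k-2} x` (`a > 0`)
at `x = ±1`, `W'(s) → +∞` and `W'(-s) → -∞` as `s → ∞`, so the continuous `W'` takes every
value. [cite: ReyBelletThomas2002, §1 H1] -/
theorem surjective_deriv (h : RBGrowth W k) (hk : 1 < k) : Function.Surjective (deriv W) := by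
  obtain ⟨hW, a, ha, -, hlim, -⟩ := h
  have hc : Continuous (deriv W) := hW.continuous_deriv (by exact_mod_cast le_top)
  have hpow : Tendsto (fun s : ℝ => s ^ (k - 1)) atTop atTop := tendsto_rpow_atTop (by linarith)
  have hak : 0 < a * k := mul_pos ha (by linarith)
  -- along `x = 1`
  have h1 : Tendsto (fun s : ℝ => deriv W s) atTop atTop := by
    have hl : Tendsto (fun s : ℝ => deriv W s / s ^ (k - 1)) atTop (𝓝 (a * k)) := by
      simpa using hlim 1
    refine (hl.pos_mul_atTop hak hpow).congr' ?_
    filter_upwards [eventually_gt_atTop 0] with s hs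
    rw [div_mul_cancel₀ _ (Real.rpow_pos_of_pos hs _).ne']
  -- along `x = -1`
  have h2 : Tendsto (fun s : ℝ => deriv W (-s)) atTop atBot := by
    have hl : Tendsto (fun s : ℝ => deriv W (-s) / s ^ (k - 1)) atTop (𝓝 (-(a * k))) := by
      have := hlim (-1)
      simpa using this
    have hak' : -(a * k) < 0 := by linarith
    refine (hl.neg_mul_atTop hak' hpow).congr' ?_
    filter_upwards [eventually_gt_atTop 0] with s hs
    rw [div_mul_cancel₀ _ (Real.rpow_pos_of_pos hs _).ne']
  intro c
  obtain ⟨s₁, hs₁⟩ := (h1.eventually_ge_atTop c).exists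
  obtain ⟨s₂, hs₂⟩ := (h2.eventually_le_atBot c).exists
  exact mem_range_of_exists_le_of_exists_ge hc ⟨-s₂, hs₂⟩ ⟨s₁, hs₁⟩

end RBGrowth

/-! ### Componentwise integrals on the extended phase space -/

/-- The integral of a continuous path in the extended phase space, read componentwise.
[folklore] -/
theorem integral_rbPhaseSpace_apply {f : ℝ → RBPhaseSpace N} (hf : Continuous f) (a b : ℝ) :
    ((∫ s in a..b, f s).1.1 = fun i => ∫ s in a..b, (f s).1.1 i) ∧
      ((∫ s in a..b, f s).1.2 = fun i => ∫ s in a..b, (f s).1.2 i) ∧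
      (∫ s in a..b, f s).2.1 = (∫ s in a..b, (f s).2.1) ∧
      (∫ s in a..b, f s).2.2 = ∫ s in a..b, (f s).2.2 := by
  have hfi : IntervalIntegrable f volume a b := hf.intervalIntegrable _ _
  have h1 : (∫ s in a..b, f s).1 = ∫ s in a..b, (f s).1 :=
    ((ContinuousLinearMap.fst ℝ (PhaseSpace N) (ℝ × ℝ)).intervalIntegral_comp_comm hfi).symm
  have h2 : (∫ s in a..b, f s).2 = ∫ s in a..b, (f s).2 :=
    ((ContinuousLinearMap.snd ℝ (PhaseSpace N) (ℝ × ℝ)).intervalIntegral_comp_comm hfi).symm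
  obtain ⟨h11, h12⟩ := OscillatorChain.integral_phaseSpace_apply (continuous_fst.comp hf) a b
  have hfi2 : IntervalIntegrable (fun s => (f s).2) volume a b :=
    (continuous_snd.comp hf).intervalIntegrable _ _
  have h21 : (∫ s in a..b, (f s).2).1 = ∫ s in a..b, (f s).2.1 :=
    ((ContinuousLinearMap.fst ℝ ℝ ℝ).intervalIntegral_comp_comm hfi2).symm
  have h22 : (∫ s in a..b, (f s).2).2 = ∫ s in a..b, (f s).2.2 :=
    ((ContinuousLinearMap.snd ℝ ℝ ℝ).intervalIntegral_comp_comm hfi2).symm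
  refine ⟨?_, ?_, ?_, ?_⟩
  · rw [h1]; exact h11
  · rw [h1]; exact h12
  · rw [h2]; exact h21
  · rw [h2]; exact h22

/-! ### A Lipschitz bound for `r(t) - r(0) - ∫₀ᵗ h` -/

/-- For `r ∈ C²` and `h` continuous, `t ↦ r(t) - r(0) - ∫₀ᵗ h` is Lipschitz on `[0, T]`
(mean value for `r`, boundedness of `h`). [folklore] -/
theorem exists_lipschitz_sub_integral {r h : ℝ → ℝ} (hr : ContDiff ℝ 2 r) (hh : Continuous h)
    (T : ℝ) : ∃ L : ℝ, 0 ≤ L ∧ ∀ s u : ℝ, 0 ≤ s → s ≤ u → u ≤ T →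
      |(r u - r 0 - ∫ x in (0 : ℝ)..u, h x) - (r s - r 0 - ∫ x in (0 : ℝ)..s, h x)| ≤ L * (u - s) := by
  have hr' : Continuous (deriv r) := OscillatorChain.continuous_deriv_of_two hr
  have hrd : Differentiable ℝ r := hr.differentiable (by norm_num)
  obtain ⟨M₁, hM₁⟩ := isCompact_Icc.exists_bound_of_continuousOn (hr'.continuousOn (s := Icc 0 T))
  obtain ⟨M₂, hM₂⟩ := isCompact_Icc.exists_bound_of_continuousOn (hh.continuousOn (s := Icc 0 T))
  refine ⟨max M₁ 0 + max M₂ 0, by positivity, fun s u hs hsu huT => ?_⟩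
  have hsub : (r u - r 0 - ∫ x in (0 : ℝ)..u, h x) - (r s - r 0 - ∫ x in (0 : ℝ)..s, h x) =
      (∫ x in s..u, deriv r x) - ∫ x in s..u, h x := by
    rw [intervalIntegral.integral_deriv_eq_sub (fun x _ => hrd x) (hr'.intervalIntegrable _ _),
      ← intervalIntegral.integral_interval_sub_left (a := (0 : ℝ)) (b := u) (c := s)
        (hh.intervalIntegrable _ _) (hh.intervalIntegrable _ _)]
    ring
  rw [hsub]
  have hI : ∀ x ∈ Ι s u, x ∈ Icc 0 T := fun x hx => by
    rw [uIoc_of_le hsu] at hx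
    exact ⟨hs.trans hx.1.le, hx.2.trans huT⟩
  have h1 : |∫ x in s..u, deriv r x| ≤ max M₁ 0 * (u - s) := by
    have h := intervalIntegral.norm_integral_le_of_norm_le_const (f := deriv r) (a := s) (b := u)
      (C := max M₁ 0) fun x hx => (hM₁ x (hI x hx)).trans (le_max_left _ _)
    rwa [Real.norm_eq_abs, abs_of_nonneg (sub_nonneg.2 hsu)] at h
  have h2 : |∫ x in s..u, h x| ≤ max M₂ 0 * (u - s) := by
    have h := intervalIntegral.norm_integral_le_of_norm_le_const (f := h) (a := s) (b := u)
      (C := max M₂ 0) fun x hx => (hM₂ x (hI x hx)).trans (le_max_left _ _)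
    rwa [Real.norm_eq_abs, abs_of_nonneg (sub_nonneg.2 hsu)] at h
  calc |(∫ x in s..u, deriv r x) - ∫ x in s..u, h x|
      ≤ |∫ x in s..u, deriv r x| + |∫ x in s..u, h x| := abs_sub _ _
    _ ≤ max M₁ 0 * (u - s) + max M₂ 0 * (u - s) := add_le_add h1 h2
    _ = (max M₁ 0 + max M₂ 0) * (u - s) := by ring

/-- Pulling a constant condition out of an interval integral. [folklore] -/
theorem integral_ite_const (p : Prop) [Decidable p] (f : ℝ → ℝ) (a b : ℝ) :
    ∫ x in a..b, (if p then f x else 0) = if p then ∫ x in a..b, f x else 0 := by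
  split_ifs <;> simp

namespace OscillatorChain

variable {P : OscillatorChain} {k₁ k₂ : ℝ} (hU : RBGrowth P.U k₁) (hV : RBGrowth P.V k₂)
  (hk₁ : 1 ≤ k₁) (hk₂ : 1 < k₂) (hγ : 0 ≤ P.γ) {Λ : ℝ} (hΛ : Λ ≠ 0) (m : ℕ)
include hU hV hk₁ hk₂ hγ hΛ

/-- **Controllability of the control system (46) of Rey-Bellet–Thomas** (one end suffices, `V'`
merely onto): for the `(m+1)`-site effective model, all `x₀, x_T` in the extended phase space,
`T > 0` and `ε > 0`, there is a noise path `n` — continuous, with values in the reservoir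
subspace, `n(0) = 0`, Lipschitz on `[0, T]` — such that the trajectory of
`z(t) = x₀ + n(t) + ∫₀ᵗ Y(z)` (`Y = rbDrift`, `drivenFlow`) satisfies `dist (z T) x_T ≤ ε`.
Construction: a force profile `φ` steering the chain (`chain_approxControl`); `r_L ∈ C²` from
`x₀.r_L` to `x_T.r_L` with `-Λ r_L` tracking `φ` in `L¹`, `r_R ∈ C²` from `x₀.r_R` to `x_T.r_R`
with `Λ r_R` small in `L¹` (`exists_contDiff_forceTracking'`); the chain trajectory under the
actual reservoir forces stays `ε/2`-close (robustness); `n` is read off the `r`-equations.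
[cite: ReyBelletThomas2002, Prop 4.2] -/
theorem rb_exists_control {T : ℝ} (hT : 0 < T) (x₀ xT : RBPhaseSpace (m + 1)) {ε : ℝ}
    (hε : 0 < ε) :
    ∃ (n : ℝ → RBPhaseSpace (m + 1)) (L : ℝ), Continuous n ∧ (∀ t, n t ∈ rbNoise (m + 1)) ∧
      n 0 = 0 ∧ 0 ≤ L ∧
      (∀ s u : ℝ, 0 ≤ s → s ≤ u → u ≤ T → ‖n u - n s‖ ≤ L * (u - s)) ∧
      dist (drivenFlow (P.rbDrift Λ (m + 1)) x₀ n T) xT ≤ ε := by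
  have hU2 : ContDiff ℝ 2 P.U := hU.1.of_le (by norm_cast)
  have hV2 : ContDiff ℝ 2 P.V := hV.1.of_le (by norm_cast)
  have hUd : Differentiable ℝ P.U := hU2.differentiable (by norm_num)
  have hVd : Differentiable ℝ P.V := hV2.differentiable (by norm_num)
  have hVs : Function.Surjective (deriv P.V) := hV.surjective_deriv hk₂
  -- 1. the chain control
  obtain ⟨φ, hφc, z₁, hz₁c, hz₁, hdist₁⟩ :=
    chain_approxControl hU2 hV2 hVs m hT x₀.1 xT.1 (half_pos hε)
  -- 2. robustness of the chain trajectory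
  obtain ⟨δ, hδ, hrob⟩ := hz₁.exists_near_of_forcing (contDiff_chainField hU2 hV2 (m + 1)) hz₁c
    (half_pos hε)
  -- 3. the reservoir paths
  have hwc : Continuous fun r : ℝ => -Λ * r := by fun_prop
  have hws : Function.Surjective fun r : ℝ => -Λ * r := fun c =>
    ⟨-c / Λ, by field_simp⟩
  obtain ⟨rL, hrL, hrL0, -, hrLT, -, htrL⟩ := exists_contDiff_forceTracking' hwc hws hT
    hφc.continuousOn x₀.2.1 0 xT.2.1 0 (half_pos hδ)
  obtain ⟨rR, hrR, hrR0, -, hrRT, -, htrR⟩ := exists_contDiff_forceTracking' hwc hws hT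
    (continuousOn_const (c := (0 : ℝ))) x₀.2.2 0 xT.2.2 0 (half_pos hδ)
  have hrLc : Continuous rL := hrL.continuous
  have hrRc : Continuous rR := hrR.continuous
  -- 4. the chain forcing by the actual reservoir forces
  set a : Fin (m + 1) → ℝ := fun i => if i.val = 0 then 1 else 0 with ha
  set b : Fin (m + 1) → ℝ := fun i => if i.val = m + 1 - 1 then 1 else 0 with hb
  have ha1 : ∀ i, |a i| ≤ 1 := fun i => by simp only [ha]; split_ifs <;> simp
  have hb1 : ∀ i, |b i| ≤ 1 := fun i => by simp only [hb]; split_ifs <;> simp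
  have hite : ∀ (i : Fin (m + 1)) (u v : ℝ),
      ((if i.val = 0 then u else 0) + (if i.val = m + 1 - 1 then v else 0)) = a i * u + b i * v :=
    fun i u v => by simp only [ha, hb]; split_ifs <;> ring
  have hfd : ∀ i : Fin (m + 1), (forceDir m).2 i = a i := fun i => by
    simp only [forceDir, ha, Pi.single_apply, Fin.ext_iff, Fin.val_zero]
  set c : ℝ → Fin (m + 1) → ℝ := fun s i => -Λ * (a i * rL s + b i * rR s) with hc
  have hcc : ∀ i, Continuous fun s => c s i := fun i => by simp only [hc]; fun_prop
  have hΛL : Continuous fun s => -Λ * rL s := by fun_prop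
  have hΛR : Continuous fun s => -Λ * rR s := by fun_prop
  have hcint : ∀ (i) (t : ℝ), ∫ s in (0 : ℝ)..t, c s i =
      a i * (∫ s in (0 : ℝ)..t, -Λ * rL s) + b i * ∫ s in (0 : ℝ)..t, -Λ * rR s := by
    intro i t
    have e : (fun s => c s i) = fun s => a i * (-Λ * rL s) + b i * (-Λ * rR s) :=
      funext fun s => by simp only [hc]; ring
    rw [e, intervalIntegral.integral_add ((hΛL.const_mul _).intervalIntegrable _ _)
      ((hΛR.const_mul _).intervalIntegrable _ _)]
    simp only [intervalIntegral.integral_const_mul]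
  set g : ℝ → PhaseSpace (m + 1) := fun t =>
    (x₀.1.1, fun i => x₀.1.2 i + ∫ s in (0 : ℝ)..t, c s i) with hg
  have hgc : Continuous g := by
    refine continuous_const.prodMk (continuous_pi fun i => continuous_const.add ?_)
    exact intervalIntegral.continuous_primitive (fun _ _ => (hcc i).intervalIntegrable _ _) 0
  have hpert : ∀ t ∈ Icc 0 T, ‖g t - chainForcing m x₀.1 φ t‖ ≤ δ := by
    intro t ht
    have hL' : |∫ s in (0 : ℝ)..t, (-Λ * rL s - φ s)| ≤ δ / 2 := htrL t ht
    have hR' : |∫ s in (0 : ℝ)..t, -Λ * rR s| ≤ δ / 2 := by simpa using htrR t ht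
    rw [Prod.norm_def, max_le_iff]
    constructor
    · have : (g t - chainForcing m x₀.1 φ t).1 = 0 := by
        ext i; simp [hg, chainForcing_fst]
      rw [this, norm_zero]; exact hδ.le
    · rw [pi_norm_le_iff_of_nonneg hδ.le]
      intro i
      rw [Real.norm_eq_abs]
      have e : (g t - chainForcing m x₀.1 φ t).2 i =
          a i * (∫ s in (0 : ℝ)..t, (-Λ * rL s - φ s)) + b i * ∫ s in (0 : ℝ)..t, -Λ * rR s := by
        rw [intervalIntegral.integral_sub (hΛL.intervalIntegrable _ _) (hφc.intervalIntegrable _ _)]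
        simp only [Prod.snd_sub, Pi.sub_apply, hg, chainForcing, Prod.snd_add, Pi.add_apply,
          Prod.smul_snd, Pi.smul_apply, smul_eq_mul, hfd i, hcint i t,
          intervalIntegral.integral_const_mul]
        ring
      rw [e]
      calc |a i * (∫ s in (0 : ℝ)..t, (-Λ * rL s - φ s)) + b i * ∫ s in (0 : ℝ)..t, -Λ * rR s|
          ≤ |a i * ∫ s in (0 : ℝ)..t, (-Λ * rL s - φ s)| + |b i * ∫ s in (0 : ℝ)..t, -Λ * rR s| :=
            abs_add_le _ _
        _ = |a i| * |∫ s in (0 : ℝ)..t, (-Λ * rL s - φ s)| + |b i| * |∫ s in (0 : ℝ)..t, -Λ * rR s| := by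
            rw [abs_mul, abs_mul]
        _ ≤ 1 * (δ / 2) + 1 * (δ / 2) :=
            add_le_add (mul_le_mul (ha1 i) hL' (abs_nonneg _) zero_le_one)
              (mul_le_mul (hb1 i) hR' (abs_nonneg _) zero_le_one)
        _ = δ := by ring
  obtain ⟨z₂, hz₂c, hz₂, hclose⟩ := hrob g hgc hpert
  obtain ⟨hq₂, hp₂⟩ := (isIntegralSolutionOn_chain_iff hU2 hV2 hz₂c).1 hz₂
  -- 5. the trajectory on the extended phase space and its noise path
  set pL : ℝ → ℝ := fun s => ∑ i : Fin (m + 1), if i.val = 0 then (z₂ s).2 i else 0 with hpL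
  set pR : ℝ → ℝ := fun s => ∑ i : Fin (m + 1), if i.val = m + 1 - 1 then (z₂ s).2 i else 0
    with hpR
  set hL : ℝ → ℝ := fun s => -(P.γ * rL s) + Λ * pL s with hhL
  set hR : ℝ → ℝ := fun s => -(P.γ * rR s) + Λ * pR s with hhR
  have hp2c : ∀ i, Continuous fun s => (z₂ s).2 i := fun i =>
    (continuous_apply i).comp (continuous_snd.comp hz₂c)
  have hpLc : Continuous pL := continuous_finsetSum _ fun i _ => by
    split_ifs
    · exact hp2c i
    · exact continuous_const
  have hpRc : Continuous pR := continuous_finsetSum _ fun i _ => by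
    split_ifs
    · exact hp2c i
    · exact continuous_const
  have hhLc : Continuous hL := (continuous_const.mul hrLc).neg.add (continuous_const.mul hpLc)
  have hhRc : Continuous hR := (continuous_const.mul hrRc).neg.add (continuous_const.mul hpRc)
  set nL : ℝ → ℝ := fun t => rL t - rL 0 - ∫ s in (0 : ℝ)..t, hL s with hnL
  set nR : ℝ → ℝ := fun t => rR t - rR 0 - ∫ s in (0 : ℝ)..t, hR s with hnR
  have hnLc : Continuous nL := (hrLc.sub continuous_const).sub
    (intervalIntegral.continuous_primitive (fun _ _ => hhLc.intervalIntegrable _ _) 0)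
  have hnRc : Continuous nR := (hrRc.sub continuous_const).sub
    (intervalIntegral.continuous_primitive (fun _ _ => hhRc.intervalIntegrable _ _) 0)
  set n : ℝ → RBPhaseSpace (m + 1) := fun t => (0, (nL t, nR t)) with hn
  set ζ : ℝ → RBPhaseSpace (m + 1) := fun t => (z₂ t, (rL t, rR t)) with hζ
  have hnc : Continuous n := continuous_const.prodMk (hnLc.prodMk hnRc)
  have hnS : ∀ t, n t ∈ rbNoise (m + 1) := fun t => zero_prod_mem_rbNoise _
  have hζc : Continuous ζ := hz₂c.prodMk (hrLc.prodMk hrRc)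
  -- the closed form of the drift along `ζ`
  set F : RBPhaseSpace (m + 1) → RBPhaseSpace (m + 1) := fun x =>
    ((x.1.2, fun i => -P.dPotential (m + 1) i x.1.1 -
        Λ * ((if i.val = 0 then x.2.1 else 0) + (if i.val = m + 1 - 1 then x.2.2 else 0))),
      (-(P.γ * x.2.1) + Λ * ∑ i : Fin (m + 1), (if i.val = 0 then x.1.2 i else 0),
        -(P.γ * x.2.2) + Λ * ∑ i : Fin (m + 1), (if i.val = m + 1 - 1 then x.1.2 i else 0)))
    with hF
  have hFeq : P.rbDrift Λ (m + 1) = F := P.rbDrift_eq hUd hVd Λ (m + 1)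
  have hFζc : Continuous fun s => F (ζ s) := by
    rw [← hFeq]
    exact (P.contDiff_rbDrift hU.1 hV.1 Λ (m + 1)).continuous.comp hζc
  -- component functions of the integrand
  have c11 : ∀ i, (fun s => (F (ζ s)).1.1 i) = fun s => (z₂ s).2 i := fun i => rfl
  have c12 : ∀ i, (fun s => (F (ζ s)).1.2 i) = fun s => -P.dPotential (m + 1) i (z₂ s).1 + c s i :=
    fun i => funext fun s => by
      show -P.dPotential (m + 1) i (z₂ s).1 -
          Λ * ((if i.val = 0 then rL s else 0) + (if i.val = m + 1 - 1 then rR s else 0)) =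
        -P.dPotential (m + 1) i (z₂ s).1 + c s i
      rw [hite]; simp only [hc]; ring
  have c21 : (fun s => (F (ζ s)).2.1) = hL := rfl
  have c22 : (fun s => (F (ζ s)).2.2) = hR := rfl
  -- `ζ` solves the integral equation with noise `n`
  have hsolF : IsIntegralSolutionOn F (fun t => x₀ + n t) ζ T := by
    intro t ht
    obtain ⟨e11, e12, e21, e22⟩ := integral_rbPhaseSpace_apply hFζc 0 t
    refine Prod.ext (Prod.ext (funext fun i => ?_) (funext fun i => ?_)) (Prod.ext ?_ ?_)
    · -- positions
      show (z₂ t).1 i = (x₀.1.1 i + 0) + (∫ s in (0 : ℝ)..t, F (ζ s)).1.1 i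
      simp only [e11, c11, add_zero]
      rw [hq₂ t ht i]
    · -- momenta
      show (z₂ t).2 i = (x₀.1.2 i + 0) + (∫ s in (0 : ℝ)..t, F (ζ s)).1.2 i
      have hdc : Continuous fun s => -P.dPotential (m + 1) i (z₂ s).1 :=
        ((continuous_dPotential hU2 hV2 (m + 1) i).comp (continuous_fst.comp hz₂c)).neg
      simp only [e12, c12, add_zero]
      rw [intervalIntegral.integral_add (hdc.intervalIntegrable _ _) ((hcc i).intervalIntegrable _ _),
        intervalIntegral.integral_neg, hp₂ t ht i]
      simp only [hg]
      ring
    · -- `r_L`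
      show rL t = (x₀.2.1 + nL t) + (∫ s in (0 : ℝ)..t, F (ζ s)).2.1
      rw [e21, c21]
      simp only [hnL, hrL0]
      ring
    · -- `r_R`
      show rR t = (x₀.2.2 + nR t) + (∫ s in (0 : ℝ)..t, F (ζ s)).2.2
      rw [e22, c22]
      simp only [hnR, hrR0]
      ring
  have hsol : IsIntegralSolutionOn (P.rbDrift Λ (m + 1)) (fun t => x₀ + n t) ζ T :=
    hsolF.congr_field fun t _ => by rw [hFeq]
  -- hence `ζ` is the driven flow
  set D := P.rbConfinedDrift hU hV hk₁ hk₂.le hγ Λ (m + 1) with hD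
  have hflow : EqOn ζ (drivenFlow (P.rbDrift Λ (m + 1)) x₀ n) (Icc 0 T) :=
    D.eqOn_flow x₀ hnc hnS hsol hζc
  -- Lipschitz bound for `n` on `[0, T]`
  obtain ⟨L₁, hL₁, hL₁b⟩ := exists_lipschitz_sub_integral hrL hhLc T
  obtain ⟨L₂, hL₂, hL₂b⟩ := exists_lipschitz_sub_integral hrR hhRc T
  refine ⟨n, L₁ + L₂, hnc, hnS, ?_, by positivity, fun s u hs hsu huT => ?_, ?_⟩
  · simp [hn, hnL, hnR]
  · rw [Prod.norm_def, max_le_iff]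
    constructor
    · simp only [hn, Prod.fst_sub, sub_self, norm_zero]; positivity
    · rw [Prod.norm_def, max_le_iff]
      have h1 := hL₁b s u hs hsu huT
      have h2 := hL₂b s u hs hsu huT
      have hus : 0 ≤ u - s := sub_nonneg.2 hsu
      constructor
      · simp only [hn, Prod.snd_sub, Prod.fst_sub, Real.norm_eq_abs, hnL]
        exact h1.trans (by nlinarith)
      · simp only [hn, Prod.snd_sub, Real.norm_eq_abs, hnR]
        exact h2.trans (by nlinarith)
  · rw [← hflow ⟨hT.le, le_rfl⟩]
    simp only [hζ]
    rw [Prod.dist_eq, max_le_iff]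
    constructor
    · calc dist (z₂ T) xT.1 ≤ dist (z₂ T) (z₁ T) + dist (z₁ T) xT.1 := dist_triangle _ _ _
        _ ≤ ε / 2 + ε / 2 :=
            add_le_add (by rw [dist_eq_norm]; exact hclose T ⟨hT.le, le_rfl⟩) hdist₁
        _ = ε := by ring
    · rw [hrLT, hrRT]
      simp [hε.le]

/-- **Rey-Bellet–Thomas 2002, Proposition 4.2 (irreducibility at every positive time).** Under
H1 (`1 ≤ k₁`, `1 < k₂`), `γ > 0`, `Λ ≠ 0`, `N = m + 1 ≥ 1` and `T_L, T_R > 0`: for every `t > 0`,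
every `x` and every nonempty open `U`, `P_t(x, U) > 0`. Proof: the controlled trajectory of
`rb_exists_control` ends in `U`; its noise path is `f₁ v_L + f₂ v_R` with `fᵢ` Lipschitz
(`v_b = √(2γT_b) e_{r_b}`); the support theorem (`sdeKernel_pos_of_flow_mem`) applies.
[cite: ReyBelletThomas2002, Prop 4.2] -/
theorem rb_kernel_pos_of_isOpen (hγ' : 0 < P.γ) {T_L T_R : ℝ} (hTL : 0 < T_L) (hTR : 0 < T_R)
    (x : RBPhaseSpace (m + 1)) {U : Set (RBPhaseSpace (m + 1))} (hUo : IsOpen U)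
    (hne : U.Nonempty) {t : ℝ≥0} (ht : 0 < t) :
    0 < P.rbKernel Λ (m + 1) T_L T_R t x U := by
  obtain ⟨xT, hxT⟩ := hne
  obtain ⟨ρ, hρ, hρU⟩ := Metric.isOpen_iff.1 hUo xT hxT
  have ht' : 0 < (t : ℝ) := ht
  obtain ⟨n, L, hnc, hnS, hn0, hL, hLip, hdist⟩ :=
    rb_exists_control hU hV hk₁ hk₂ hγ hΛ m ht' x xT (half_pos hρ)
  -- the controls along the noise vectors
  set cL : ℝ := Real.sqrt (2 * P.γ * T_L) with hcL
  set cR : ℝ := Real.sqrt (2 * P.γ * T_R) with hcR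
  have hcL0 : 0 < cL := Real.sqrt_pos.2 (by positivity)
  have hcR0 : 0 < cR := Real.sqrt_pos.2 (by positivity)
  set f₁ : ℝ → ℝ := fun s => (n s).2.1 / cL with hf₁
  set f₂ : ℝ → ℝ := fun s => (n s).2.2 / cR with hf₂
  have hf₁c : Continuous f₁ :=
    ((continuous_fst.comp (continuous_snd.comp hnc))).div_const _
  have hf₂c : Continuous f₂ :=
    ((continuous_snd.comp (continuous_snd.comp hnc))).div_const _
  have hpath : controlPath (P.rbNoiseVec (m + 1) T_L T_R 0) (P.rbNoiseVec (m + 1) T_L T_R 1) f₁ f₂ =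
      n := by
    funext s
    have h1 : (n s).1 = 0 := mem_rbNoise.1 (hnS s)
    simp only [controlPath, rbNoiseVec, Matrix.cons_val_zero, Matrix.cons_val_one,
      hf₁, hf₂, smul_smul, rbUnitRL_eq, rbUnitRR_eq]
    rw [div_mul_cancel₀ _ hcL0.ne', div_mul_cancel₀ _ hcR0.ne']
    refine Prod.ext ?_ (Prod.ext ?_ ?_)
    · simp [h1]
    · simp
    · simp
  have hmem : drivenFlow (P.rbDrift Λ (m + 1)) x
      (controlPath (P.rbNoiseVec (m + 1) T_L T_R 0) (P.rbNoiseVec (m + 1) T_L T_R 1) f₁ f₂) t ∈ U := by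
    rw [hpath]
    refine hρU (mem_ball.2 (lt_of_le_of_lt hdist (half_lt_self hρ)))
  -- Lipschitz bounds for the controls
  have hcomp : ∀ s u : ℝ, |(n u).2.1 - (n s).2.1| ≤ ‖n u - n s‖ ∧ |(n u).2.2 - (n s).2.2| ≤ ‖n u - n s‖ :=
    fun s u => ⟨(Real.norm_eq_abs _ ▸ norm_fst_le (n u - n s).2).trans (norm_snd_le _),
      (Real.norm_eq_abs _ ▸ norm_snd_le (n u - n s).2).trans (norm_snd_le _)⟩
  set L' : ℝ := L / cL + L / cR with hL'
  have hL'0 : 0 ≤ L' := by positivity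
  have hLip₁ : ∀ s u : ℝ, 0 ≤ s → s ≤ u → u ≤ t → |f₁ u - f₁ s| ≤ L' * (u - s) := by
    intro s u hs hsu hut
    have h := (hcomp s u).1.trans (hLip s u hs hsu hut)
    have hus : 0 ≤ u - s := sub_nonneg.2 hsu
    simp only [hf₁]
    rw [← sub_div, abs_div, abs_of_pos hcL0, div_le_iff₀ hcL0]
    calc |(n u).2.1 - (n s).2.1| ≤ L * (u - s) := h
      _ = L / cL * (u - s) * cL := by field_simp
      _ ≤ L' * (u - s) * cL := by gcongr; exact le_add_of_nonneg_right (by positivity)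
  have hLip₂ : ∀ s u : ℝ, 0 ≤ s → s ≤ u → u ≤ t → |f₂ u - f₂ s| ≤ L' * (u - s) := by
    intro s u hs hsu hut
    have h := (hcomp s u).2.trans (hLip s u hs hsu hut)
    have hus : 0 ≤ u - s := sub_nonneg.2 hsu
    simp only [hf₂]
    rw [← sub_div, abs_div, abs_of_pos hcR0, div_le_iff₀ hcR0]
    calc |(n u).2.2 - (n s).2.2| ≤ L * (u - s) := h
      _ = L / cR * (u - s) * cR := by field_simp
      _ ≤ L' * (u - s) * cR := by gcongr; exact le_add_of_nonneg_left (by positivity)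
  have hf₁0 : f₁ 0 = 0 := by simp [hf₁, hn0]
  have hf₂0 : f₂ 0 = 0 := by simp [hf₂, hn0]
  exact (P.rbConfinedDrift hU hV hk₁ hk₂.le hγ Λ (m + 1)).sdeKernel_pos_of_flow_mem
    (P.rbNoiseVec_mem (m + 1) T_L T_R 0) (P.rbNoiseVec_mem (m + 1) T_L T_R 1) x hf₁c hf₂c hf₁0
    hf₂0 hL'0 hLip₁ hLip₂ hUo hmem

omit hΛ m in
/-- **Irreducibility of (RBT-SDE)** in the form consumed by the §5 assembly: under the hypotheses
of Theorem 2.1 (indeed H1 with `k₂ > 1`, `γ, Λ, T_L, T_R > 0`, `N ≥ 1`), every nonempty open set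
is charged from every point at some (indeed every) positive time.
[cite: ReyBelletThomas2002, Prop 4.2] -/
theorem rb_irreducible (hγ' : 0 < P.γ) {Λ : ℝ} (hΛ : Λ ≠ 0) {N : ℕ} (hN : 1 ≤ N) {T_L T_R : ℝ}
    (hTL : 0 < T_L) (hTR : 0 < T_R) (z : RBPhaseSpace N) (U : Set (RBPhaseSpace N))
    (hUo : IsOpen U) (hne : U.Nonempty) :
    ∃ t : ℝ≥0, 0 < t ∧ 0 < P.rbKernel Λ N T_L T_R t z U := by
  obtain ⟨m, rfl⟩ : ∃ m, N = m + 1 := ⟨N - 1, by omega⟩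
  exact ⟨1, one_pos, rb_kernel_pos_of_isOpen hU hV hk₁ hk₂ hγ hΛ m hγ' hTL hTR z hUo hne one_pos⟩

end OscillatorChain

end Literature.MathematicalPhysics.KineticTheory.HeatConduction

end
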